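import Mathlib
import HarnessLib

/-!
# The two-dimensional discrete Fourier transform (Davis–Rabinowitz 1984, Sect. 3.9.5.6, (6.1)–(6.3))

**Source.** P. J. Davis, P. Rabinowitz, *Methods of Numerical Integration* (2nd ed., Academic Press, 1984),
Sect. 3.9.5.6 "The Two-Dimensional DFT" (pp. 253–254).

**Statement.** The two-dimensional DFT of an `N × M` array is
`F(r, s) = Σ_{i=0}^{N-1} Σ_{j=0}^{M-1} f(i, j) w_N^{ir} w_M^{js}` (6.1).  Writing
`F(r, s) = Σ_i [Σ_j f(i, j) w_M^{js}] w_N^{ir} = Σ_i f'(i, s) w_N^{ir}` (6.2), the transform is computed by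
taking the `M`-point (one-dimensional) DFT of each of the `N` rows and then the `N`-point DFT of each of the
`M` columns of the result (or in the other order); with the FFT this costs about
`MN(log₂ N + log₂ M) = NM log₂ NM` operations (6.3).

**What is typed** (all PROVED, Mathlib only), for Mathlib's transform `ZMod.dft` (notation `𝓕`, kernel
`stdAddChar (-(j k)) = e^{-2πi jk/N}`, i.e. the text's `w` replaced by `w̄` — the opposite, equally common, sign
convention, as in the one-dimensional anchor of Sect. 3.9.5.3):
* `dft2` — the transform (6.1) of `f : ZMod N × ZMod M → ℂ`;
* `dft2_apply_eq_dft_rows` — (6.2): `𝓕₂ f (r, s) = 𝓕 (fun i ↦ 𝓕 (fun j ↦ f (i, j)) s) r` (rows first),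
  and `dft2_apply_eq_dft_cols` (columns first); `dft2_transpose` (the transform commutes with transposition);
* `dft2_dft2` — the two-dimensional inversion formula `𝓕₂ (𝓕₂ f) (-i, -j) = N M f (i, j)` obtained by applying
  Mathlib's one-dimensional `ZMod.dft_dft` twice, and `dft2_inversion` (the array recovered from its transform);
* `twoDimFFT_opCount` — the operation count (6.3) `MN(log₂ N + log₂ M) = NM log₂ (NM)`.

Not typed: the two-dimensional convolution (6.4) and the `12 p² log₂ p²` versus `(p − N)² N²` comparison.

References: [cite: DavisRabinowitz1984, Sect. 3.9.5.6 (6.1)-(6.3)].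
-/

open Finset Complex ZMod

noncomputable section

namespace Literature.Analysis.Quadrature

variable {N M : ℕ} [NeZero N] [NeZero M]

/-- The two-dimensional DFT (6.1) of an `N × M` array, in Mathlib's sign convention:
`𝓕₂ f (r, s) = Σ_i Σ_j e^{-2πi ir/N} e^{-2πi js/M} f(i, j)`.
[cite: DavisRabinowitz1984, Sect. 3.9.5.6 (6.1)] -/
def dft2 (f : ZMod N × ZMod M → ℂ) : ZMod N × ZMod M → ℂ := fun p =>
  ∑ i : ZMod N, ∑ j : ZMod M, (stdAddChar (-(i * p.1)) : ℂ) * (stdAddChar (-(j * p.2)) : ℂ) * f (i, j)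

/-- (6.1) unfolded at a point. [cite: DavisRabinowitz1984, Sect. 3.9.5.6 (6.1)] -/
theorem dft2_apply (f : ZMod N × ZMod M → ℂ) (r : ZMod N) (s : ZMod M) :
    dft2 f (r, s) =
      ∑ i : ZMod N, ∑ j : ZMod M, (stdAddChar (-(i * r)) : ℂ) * (stdAddChar (-(j * s)) : ℂ) * f (i, j) :=
  rfl

/-- **Row–column decomposition** (6.2): the two-dimensional DFT is the `N`-point DFT (in `i`) of the
`M`-point DFTs of the rows `j ↦ f(i, j)`: `𝓕₂ f (r, s) = 𝓕 (fun i ↦ 𝓕 (f(i, ·)) s) r`.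
[cite: DavisRabinowitz1984, Sect. 3.9.5.6 (6.2)] -/
theorem dft2_apply_eq_dft_rows (f : ZMod N × ZMod M → ℂ) (r : ZMod N) (s : ZMod M) :
    dft2 f (r, s) = 𝓕 (fun i : ZMod N => 𝓕 (fun j : ZMod M => f (i, j)) s) r := by
  rw [dft2_apply, dft_apply]
  refine sum_congr rfl fun i _ => ?_
  rw [dft_apply, smul_eq_mul, mul_sum]
  refine sum_congr rfl fun j _ => ?_
  rw [smul_eq_mul]
  ring

/-- The same decomposition in the other order: first the `N`-point DFTs of the columns `i ↦ f(i, j)`,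
then the `M`-point DFT in `j`. [cite: DavisRabinowitz1984, Sect. 3.9.5.6 (6.2)] -/
theorem dft2_apply_eq_dft_cols (f : ZMod N × ZMod M → ℂ) (r : ZMod N) (s : ZMod M) :
    dft2 f (r, s) = 𝓕 (fun j : ZMod M => 𝓕 (fun i : ZMod N => f (i, j)) r) s := by
  rw [dft2_apply, sum_comm, dft_apply]
  refine sum_congr rfl fun j _ => ?_
  rw [dft_apply, smul_eq_mul, mul_sum]
  refine sum_congr rfl fun i _ => ?_
  rw [smul_eq_mul]
  ring

/-- The two-dimensional DFT commutes with transposition of the array.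
[cite: DavisRabinowitz1984, Sect. 3.9.5.6 (6.1)-(6.2)] -/
theorem dft2_transpose (f : ZMod N × ZMod M → ℂ) (r : ZMod N) (s : ZMod M) :
    dft2 (fun q : ZMod M × ZMod N => f (q.2, q.1)) (s, r) = dft2 f (r, s) := by
  rw [dft2_apply_eq_dft_rows, dft2_apply_eq_dft_cols]

/-- The two-dimensional DFT is additive. [cite: DavisRabinowitz1984, Sect. 3.9.5.6 (6.1)] -/
theorem dft2_add (f g : ZMod N × ZMod M → ℂ) : dft2 (f + g) = dft2 f + dft2 g := by
  funext p
  rcases p with ⟨r, s⟩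
  simp only [Pi.add_apply, dft2_apply, mul_add, sum_add_distrib]

/-- The two-dimensional DFT is homogeneous. [cite: DavisRabinowitz1984, Sect. 3.9.5.6 (6.1)] -/
theorem dft2_smul (c : ℂ) (f : ZMod N × ZMod M → ℂ) : dft2 (c • f) = c • dft2 f := by
  funext p
  rcases p with ⟨r, s⟩
  simp only [Pi.smul_apply, smul_eq_mul, dft2_apply, mul_sum]
  refine sum_congr rfl fun i _ => sum_congr rfl fun j _ => ?_
  ring

/-- **Two-dimensional inversion**, from Mathlib's one-dimensional `ZMod.dft_dft` applied along rows and
columns: `𝓕₂ (𝓕₂ f) (-i, -j) = N M f(i, j)`. [cite: DavisRabinowitz1984, Sect. 3.9.5.6 (6.1)-(6.2)] -/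
theorem dft2_dft2 (f : ZMod N × ZMod M → ℂ) (i : ZMod N) (j : ZMod M) :
    dft2 (dft2 f) (-i, -j) = (N : ℂ) * (M : ℂ) * f (i, j) := by
  rw [dft2_apply_eq_dft_cols]
  have hrows : ∀ s : ZMod M, (fun r : ZMod N => dft2 f (r, s)) =
      𝓕 (fun i' : ZMod N => 𝓕 (fun j' : ZMod M => f (i', j')) s) := by
    intro s; funext r; exact dft2_apply_eq_dft_rows f r s
  have h1 : ∀ s : ZMod M, 𝓕 (fun r : ZMod N => dft2 f (r, s)) (-i) =
      (N : ℂ) * 𝓕 (fun j' : ZMod M => f (i, j')) s := by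
    intro s
    rw [hrows s]
    have h := congrFun (dft_dft (fun i' : ZMod N => 𝓕 (fun j' : ZMod M => f (i', j')) s)) (-i)
    simpa [smul_eq_mul] using h
  simp_rw [h1]
  have h2 : 𝓕 (fun s : ZMod M => (N : ℂ) * 𝓕 (fun j' : ZMod M => f (i, j')) s) (-j) =
      (N : ℂ) * 𝓕 (𝓕 (fun j' : ZMod M => f (i, j'))) (-j) := by
    have : (fun s : ZMod M => (N : ℂ) * 𝓕 (fun j' : ZMod M => f (i, j')) s) =
        (N : ℂ) • 𝓕 (fun j' : ZMod M => f (i, j')) := by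
      funext s; simp [smul_eq_mul]
    rw [this, _root_.map_smul, Pi.smul_apply, smul_eq_mul]
  rw [h2]
  have h3 := congrFun (dft_dft (fun j' : ZMod M => f (i, j'))) (-j)
  simp only [neg_neg, smul_eq_mul] at h3
  rw [h3]
  ring

/-- **Inversion formula**: the array is recovered from its two-dimensional transform,
`f(i, j) = (N M)⁻¹ 𝓕₂ (𝓕₂ f) (-i, -j)`. [cite: DavisRabinowitz1984, Sect. 3.9.5.6 (6.1)-(6.2)] -/
theorem dft2_inversion (f : ZMod N × ZMod M → ℂ) (i : ZMod N) (j : ZMod M) :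
    f (i, j) = ((N : ℂ) * (M : ℂ))⁻¹ * dft2 (dft2 f) (-i, -j) := by
  rw [dft2_dft2]
  have hN : (N : ℂ) ≠ 0 := Nat.cast_ne_zero.mpr (NeZero.ne N)
  have hM : (M : ℂ) ≠ 0 := Nat.cast_ne_zero.mpr (NeZero.ne M)
  field_simp

/-- The two-dimensional DFT is injective (a consequence of the inversion formula).
[cite: DavisRabinowitz1984, Sect. 3.9.5.6 (6.1)-(6.2)] -/
theorem dft2_injective : Function.Injective (dft2 : (ZMod N × ZMod M → ℂ) → ZMod N × ZMod M → ℂ) := by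
  intro f g h
  funext p
  rcases p with ⟨i, j⟩
  rw [dft2_inversion f i j, dft2_inversion g i j, h]

/-- **Operation count** (6.3): `N` row transforms of length `M` and `M` column transforms of length `N`
cost about `MN(log₂ N + log₂ M) = NM log₂ (NM)` operations.
[cite: DavisRabinowitz1984, Sect. 3.9.5.6 (6.3)] -/
theorem twoDimFFT_opCount {N M : ℕ} (hN : 0 < N) (hM : 0 < M) :
    (M : ℝ) * N * (Real.logb 2 N + Real.logb 2 M) = (N : ℝ) * M * Real.logb 2 ((N : ℝ) * M) := by
  have hN' : (N : ℝ) ≠ 0 := by positivity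
  have hM' : (M : ℝ) ≠ 0 := by positivity
  rw [Real.logb_mul hN' hM']
  ring

end Literature.Analysis.Quadrature

end
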